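import Mathlib
import Summits.NavierStokesRegularity.NavierStokesRegularity.Theorems.EulerZoomLiouvillePowerGaugeEulerLiouvilleSelfSimilarTransfer
import HarnessLib

/-!
# PAST-EXACT self-similar members of crux E: identification of the weak gradient on the past sub-slab
# (crux `EulerZoomLiouville.PowerGaugeEulerLiouville` = stmt-NavierStokesRegularity-19832, line `birth`, rung C1 — transport brick 1)

Route `EulerZoomLiouville` (NavierStokesRegularity); width seat ns-ezl-w1 under the interim LEAD ns-typeII-p2 g9
(assignment of 2026-08-28T03:17:55Z).  The tree's `exists_profileGradient_ae` (`…SelfSimilarTransfer`) identifies ANY weak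
spatial gradient `H` of a member that is exactly self-similar about the space-time ORIGIN at ALL times `τ < 0` with the
self-similar gradient `(−τ)^{−1} G((−τ)^{−γ} ·)` of a profile gradient `G` (a weak derivative of the profile `V` on `ℝ³`).
This file is its PAST / SHIFTED TWIN: the member is exactly self-similar about `(T, x₀)` with exponent `γ` and profile `V`
ON A PAST SUB-SLAB `τ < T₁` only (`T₁ ≤ 0`, `T₁ ≤ T`; arbitrary on `[T₁, 0)`):
`u(τ, x) = (T − τ)^{γ−1} V((T − τ)^{−γ}(x − x₀))` for `τ < T₁`.

* `Past.hasWeakFDerivOn_profile_of_shiftedSlice` — from a weak derivative `K` of the shifted, dilated slice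
  `x ↦ c • V(d • (x − x₀))` on `ℝ³` (`c, d > 0`) to the weak derivative `y ↦ c⁻¹ d⁻¹ K(x₀ + d⁻¹ y)` of `V`
  (affine covariance `HasWeakFDerivOn.comp_affine` + homogeneity `HasWeakFDerivOn.const_smul`);
* `Past.exists_profileGradient_ae_of_past` — THE BRICK: there is a profile gradient `G` (a.e.-strongly measurable, a weak
  derivative of `V` on `ℝ³`) with `H(τ) = (T − τ)^{−1} • G((T − τ)^{−γ}(· − x₀))` a.e. on `ℝ³`, for a.e. `τ < T₁`
  (slices of weak gradients are weak derivatives — `ae_hasWeakFDerivOn_slice_slab` —, the previous lemma, and uniqueness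
  of weak derivatives `HasWeakFDerivOn.unique_holds`, transported along `x ↦ (T − τ)^{−γ}(x − x₀)`);
* `Past.quasiMeasurePreserving_selfSimilarDilation` / `Past.uncurry_ae_eq_selfSimilarGradient` — the same identity as an
  a.e. equality on the past sub-slab `(−∞, T₁) × ℝ³` for the product measure (the form the gauge dictionary consumes).

`exists_profileGradient_ae` is the case `T = T₁ = 0`, `x₀ = 0`.  WHAT THIS IS NOT: not NS, not E, not a stub of the
skeleton — a transport lemma `--supports` stmt-19832 (brick 1 of the transport of the sub-extremal / weak-profile analysis
to members self-similar about `(T, x₀) ≠ (0, 0)` or only in the far past). [folklore]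
-/

noncomputable section

-- flat `Theorems/<Route><Decl>…` files of one crux share the namespace of the crux (tree convention: `Summit.<S>.<S>.…`)
set_option linter.dupNamespace false

open MeasureTheory Set Filter Topology Metric Function TopologicalSpace
open scoped ENNReal NNReal

namespace Summit.NavierStokesRegularity.NavierStokesRegularity.Theorems.PowerGaugeEulerLiouville

open Literature.Analysis Literature.Analysis.FunctionSpaces Literature.Analysis.FluidPDE

namespace Past

/-! ### Change of variables for weak derivatives: the shifted, dilated slice -/

/-- `affinePreimage d x₀ ⊤ = ⊤`: the affine preimage of the whole space is the whole space. [folklore] -/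
theorem affinePreimage_top (d : ℝ) (x₀ : EuclideanSpace ℝ (Fin 3)) :
    affinePreimage d x₀ (⊤ : Opens (EuclideanSpace ℝ (Fin 3))) = ⊤ := by
  ext y
  simp [coe_affinePreimage]

/-- Translated dilations `x ↦ d • (x − x₀)` of `ℝ³` (`d ≠ 0`) are quasi-measure-preserving for Lebesgue measure. [folklore] -/
theorem quasiMeasurePreserving_smul_sub {d : ℝ} (hd : d ≠ 0) (x₀ : EuclideanSpace ℝ (Fin 3)) :
    Measure.QuasiMeasurePreserving (fun x : EuclideanSpace ℝ (Fin 3) => d • (x - x₀)) volume volume :=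
  (quasiMeasurePreserving_smul hd).comp (measurePreserving_sub_right volume x₀).quasiMeasurePreserving

/-- Affine maps `y ↦ x₀ + r • y` of `ℝ³` (`r ≠ 0`) are quasi-measure-preserving for Lebesgue measure. [folklore] -/
theorem quasiMeasurePreserving_add_smul {r : ℝ} (hr : r ≠ 0) (x₀ : EuclideanSpace ℝ (Fin 3)) :
    Measure.QuasiMeasurePreserving (fun y : EuclideanSpace ℝ (Fin 3) => x₀ + r • y) volume volume :=
  (measurePreserving_add_left volume x₀).quasiMeasurePreserving.comp (quasiMeasurePreserving_smul hr)

/-- From a weak derivative `K` of the shifted, dilated slice `x ↦ c • V (d • (x − x₀))` (`c, d > 0`) on `ℝ³` to a weak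
derivative of the profile: `V` has the weak derivative `y ↦ c⁻¹ • d⁻¹ • K (x₀ + d⁻¹ • y)` on `ℝ³` (affine covariance of
weak derivatives, Evans *PDE* §5.2; `hasWeakFDerivOn_profile_of_slice` is the case `x₀ = 0`). [folklore] -/
theorem hasWeakFDerivOn_profile_of_shiftedSlice {c d : ℝ} (hc : 0 < c) (hd : 0 < d)
    (x₀ : EuclideanSpace ℝ (Fin 3))
    {V : EuclideanSpace ℝ (Fin 3) → EuclideanSpace ℝ (Fin 3)}
    {K : EuclideanSpace ℝ (Fin 3) → EuclideanSpace ℝ (Fin 3) →L[ℝ] EuclideanSpace ℝ (Fin 3)}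
    (h : HasWeakFDerivOn (⊤ : Opens (EuclideanSpace ℝ (Fin 3))) volume (fun x => c • V (d • (x - x₀))) K) :
    HasWeakFDerivOn (⊤ : Opens (EuclideanSpace ℝ (Fin 3))) volume V
      (fun y => c⁻¹ • (d⁻¹ • K (x₀ + d⁻¹ • y))) := by
  have h1 := h.comp_affine (inv_pos.2 hd) x₀
  rw [affinePreimage_top] at h1
  have h2 := h1.const_smul c⁻¹
  have e1 : (c⁻¹ • fun y : EuclideanSpace ℝ (Fin 3) => c • V (d • ((x₀ + d⁻¹ • y) - x₀))) = V := by
    funext y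
    simp only [Pi.smul_apply, add_sub_cancel_left, smul_smul, mul_inv_cancel₀ hd.ne', one_smul,
      inv_mul_cancel₀ hc.ne']
  have e2 : (c⁻¹ • fun y : EuclideanSpace ℝ (Fin 3) => d⁻¹ • K (x₀ + d⁻¹ • y)) =
      fun y => c⁻¹ • (d⁻¹ • K (x₀ + d⁻¹ • y)) := by
    funext y
    simp only [Pi.smul_apply]
  rw [e1, e2] at h2
  exact h2

/-! ### The brick: identification of the weak gradient of a past-exact self-similar member -/

/-- **Identification of the weak gradient of a PAST-EXACT self-similar member.**  Let `H` be a weak spatial gradient on the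
slab `(−∞,0) × ℝ³` of `u`, and suppose `u(τ, x) = (T − τ)^{γ−1} V((T − τ)^{−γ}(x − x₀))` for `τ < T₁`, where `T₁ ≤ 0` and
`T₁ ≤ T` (exact self-similarity about `(T, x₀)` on the past sub-slab only).  Then there is a profile gradient `G`, a weak
derivative of `V` on `ℝ³`, a.e.-strongly measurable, with `H(τ) = (T − τ)^{−1} • G((T − τ)^{−γ}(· − x₀))` a.e. on `ℝ³` for
a.e. `τ < T₁` — the weak form of `∇u(τ, x) = (T−τ)^{−1} ∇V((T−τ)^{−γ}(x − x₀))` (tree `fderiv_selfSimilarCollapse`).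
The tree's `exists_profileGradient_ae` is the case `T = T₁ = 0`, `x₀ = 0`. [folklore] -/
theorem exists_profileGradient_ae_of_past {γ : ℝ}
    {u : ℝ → EuclideanSpace ℝ (Fin 3) → EuclideanSpace ℝ (Fin 3)}
    {H : ℝ → EuclideanSpace ℝ (Fin 3) → EuclideanSpace ℝ (Fin 3) →L[ℝ] EuclideanSpace ℝ (Fin 3)}
    (hH : HasWeakSpatialGradientOn (slab (EuclideanSpace ℝ (Fin 3)) (Iio 0) isOpen_Iio) u H)
    {T T₁ : ℝ} (hT₁ : T₁ ≤ 0) (hTT₁ : T₁ ≤ T) (x₀ : EuclideanSpace ℝ (Fin 3))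
    {V : EuclideanSpace ℝ (Fin 3) → EuclideanSpace ℝ (Fin 3)}
    (hu : ∀ τ : ℝ, τ < T₁ → u τ = fun x => selfSimilarCollapse γ T V τ (x - x₀)) :
    ∃ G : EuclideanSpace ℝ (Fin 3) → EuclideanSpace ℝ (Fin 3) →L[ℝ] EuclideanSpace ℝ (Fin 3),
      AEStronglyMeasurable G volume ∧
      HasWeakFDerivOn (⊤ : Opens (EuclideanSpace ℝ (Fin 3))) volume V G ∧
      ∀ᵐ τ ∂((volume : Measure ℝ).restrict (Iio T₁)),
        H τ =ᵐ[volume] fun x => (T - τ) ^ (-1 : ℝ) • G ((T - τ) ^ (-γ) • (x - x₀)) := by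
  have hsub : Iio T₁ ⊆ Iio (0 : ℝ) := Iio_subset_Iio hT₁
  -- (1) a.e. slice below `0` is a weak derivative on `ℝ³`
  have hslice0 : ∀ᵐ τ ∂((volume : Measure ℝ).restrict (Iio (0 : ℝ))),
      HasWeakFDerivOn (⊤ : Opens (EuclideanSpace ℝ (Fin 3))) volume (u τ) (H τ) := by
    have hU : (Iio (0 : ℝ)) = ⋃ n : ℕ, Ioo (-((n : ℝ) + 1)) 0 := by
      refine subset_antisymm (fun t ht => mem_iUnion.2 ?_) (iUnion_subset fun n t ht => ht.2)
      obtain ⟨n, hn⟩ := exists_nat_gt (-t)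
      exact ⟨n, ⟨by linarith, ht⟩⟩
    rw [hU, ae_restrict_iUnion_iff]
    intro n
    have hn : HasWeakSpatialGradientOn
        (slab (EuclideanSpace ℝ (Fin 3)) (Ioo (-((n : ℝ) + 1)) 0) isOpen_Ioo) u H :=
      hH.mono (slab_mono Ioo_subset_Iio_self)
    exact hn.ae_hasWeakFDerivOn_slice_slab
  have hslice : ∀ᵐ τ ∂((volume : Measure ℝ).restrict (Iio T₁)),
      HasWeakFDerivOn (⊤ : Opens (EuclideanSpace ℝ (Fin 3))) volume (u τ) (H τ) :=
    ae_restrict_of_ae_restrict_of_subset hsub hslice0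
  -- (2) a.e. slice of `H` is a.e.-strongly measurable; `τ < T₁` a.e.
  have hHm : AEStronglyMeasurable (uncurry H)
      (((volume : Measure ℝ).restrict (Iio (0 : ℝ))).prod (volume : Measure (EuclideanSpace ℝ (Fin 3)))) := by
    have := hH.locallyIntegrableOn_grad.aestronglyMeasurable
    rw [coe_slab, Measure.volume_eq_prod, ← Measure.prod_restrict, Measure.restrict_univ] at this
    exact this
  have hmeas : ∀ᵐ τ ∂((volume : Measure ℝ).restrict (Iio T₁)),
      AEStronglyMeasurable (H τ) volume :=
    ae_restrict_of_ae_restrict_of_subset hsub hHm.prodMk_left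
  have hlt : ∀ᵐ τ ∂((volume : Measure ℝ).restrict (Iio T₁)), τ < T₁ :=
    ae_restrict_mem measurableSet_Iio
  haveI : (ae ((volume : Measure ℝ).restrict (Iio T₁))).NeBot := by
    rw [ae_neBot, Ne, Measure.restrict_eq_zero]
    simp
  obtain ⟨τ₀, ⟨hW₀, hm₀⟩, hτ₀⟩ := ((hslice.and hmeas).and hlt).exists
  -- (3) the profile gradient from the slice at `τ₀ < T₁ ≤ T`
  have hs₀ : 0 < T - τ₀ := by linarith
  set c₀ : ℝ := (T - τ₀) ^ (γ - 1) with hc₀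
  set d₀ : ℝ := (T - τ₀) ^ (-γ) with hd₀
  have hc₀p : 0 < c₀ := Real.rpow_pos_of_pos hs₀ _
  have hd₀p : 0 < d₀ := Real.rpow_pos_of_pos hs₀ _
  have huslice : ∀ {τ : ℝ}, τ < T₁ →
      u τ = fun x => (T - τ) ^ (γ - 1) • V ((T - τ) ^ (-γ) • (x - x₀)) := by
    intro τ hτ
    rw [hu τ hτ]
    rfl
  set G : EuclideanSpace ℝ (Fin 3) → EuclideanSpace ℝ (Fin 3) →L[ℝ] EuclideanSpace ℝ (Fin 3) :=
    fun y => c₀⁻¹ • (d₀⁻¹ • H τ₀ (x₀ + d₀⁻¹ • y)) with hG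
  have hVG : HasWeakFDerivOn (⊤ : Opens (EuclideanSpace ℝ (Fin 3))) volume V G := by
    rw [huslice hτ₀] at hW₀
    exact hasWeakFDerivOn_profile_of_shiftedSlice hc₀p hd₀p x₀ hW₀
  have hGm : AEStronglyMeasurable G volume := by
    have h1 : AEStronglyMeasurable (fun y => H τ₀ (x₀ + d₀⁻¹ • y)) volume :=
      hm₀.comp_quasiMeasurePreserving (quasiMeasurePreserving_add_smul (inv_pos.2 hd₀p).ne' x₀)
    exact (h1.const_smul d₀⁻¹).const_smul c₀⁻¹
  refine ⟨G, hGm, hVG, ?_⟩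
  -- (4) for every good `τ < T₁`: uniqueness of the weak derivative of `V`, transported along `x ↦ (T−τ)^{−γ}(x − x₀)`
  filter_upwards [hslice, hlt] with τ hWτ hτ
  have hs : 0 < T - τ := by linarith
  set c : ℝ := (T - τ) ^ (γ - 1) with hcdef
  set d : ℝ := (T - τ) ^ (-γ) with hddef
  have hcp : 0 < c := Real.rpow_pos_of_pos hs _
  have hdp : 0 < d := Real.rpow_pos_of_pos hs _
  rw [huslice hτ] at hWτ
  have hVG' := hasWeakFDerivOn_profile_of_shiftedSlice hcp hdp x₀ hWτ
  have huniq := HasWeakFDerivOn.unique_holds hVG' hVG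
  rw [Opens.coe_top, Measure.restrict_univ] at huniq
  have ht := (quasiMeasurePreserving_smul_sub hdp.ne' x₀).ae_eq_comp huniq
  filter_upwards [ht] with x hx
  simp only [comp_apply, smul_smul, inv_mul_cancel₀ hdp.ne', one_smul, add_sub_cancel] at hx
  -- `hx : (c⁻¹ * d⁻¹) • H τ x = G (d • (x - x₀))`
  have hcd : c * d = (T - τ) ^ (-1 : ℝ) := by
    rw [hcdef, hddef, ← Real.rpow_add hs]
    congr 1; ring
  calc H τ x = (c * d) • ((c⁻¹ * d⁻¹) • H τ x) := by
        rw [smul_smul, show c * d * (c⁻¹ * d⁻¹) = 1 by field_simp, one_smul]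
    _ = (T - τ) ^ (-1 : ℝ) • G ((T - τ) ^ (-γ) • (x - x₀)) := by rw [hx, hcd]

/-! ### Slab form: the identity as an a.e. equality on the past sub-slab -/

/-- The past self-similar space map `(τ, x) ↦ (T − τ)^{−γ}(x − x₀)` is quasi-measure-preserving from the past sub-slab
`(−∞, T₁) × ℝ³` (`T₁ ≤ T`, product Lebesgue measure) to `ℝ³` (each slice is a translated dilation). [folklore] -/
theorem quasiMeasurePreserving_selfSimilarDilation (γ : ℝ) {T T₁ : ℝ} (hTT₁ : T₁ ≤ T)
    (x₀ : EuclideanSpace ℝ (Fin 3)) :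
    Measure.QuasiMeasurePreserving
      (fun z : ℝ × EuclideanSpace ℝ (Fin 3) => (T - z.1) ^ (-γ) • (z.2 - x₀))
      (((volume : Measure ℝ).restrict (Iio T₁)).prod (volume : Measure (EuclideanSpace ℝ (Fin 3))))
      volume := by
  refine MeasureTheory.QuasiMeasurePreserving.prod_of_right
    (((measurable_const.sub measurable_fst).pow_const _).smul (measurable_snd.sub measurable_const)) ?_
  filter_upwards [ae_restrict_mem measurableSet_Iio] with τ hτ
  have hs : 0 < T - τ := by simp only [mem_Iio] at hτ; linarith
  exact quasiMeasurePreserving_smul_sub (Real.rpow_pos_of_pos hs _).ne' x₀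

/-- The self-similar gradient `(τ, x) ↦ (T − τ)^{−1} • G((T − τ)^{−γ}(x − x₀))` of an a.e.-strongly measurable profile
gradient `G` is a.e.-strongly measurable on the past sub-slab `(−∞, T₁) × ℝ³` (`T₁ ≤ T`). [folklore] -/
theorem aestronglyMeasurable_uncurry_selfSimilarGradient (γ : ℝ) {T T₁ : ℝ} (hTT₁ : T₁ ≤ T)
    (x₀ : EuclideanSpace ℝ (Fin 3))
    {G : EuclideanSpace ℝ (Fin 3) → EuclideanSpace ℝ (Fin 3) →L[ℝ] EuclideanSpace ℝ (Fin 3)}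
    (hGm : AEStronglyMeasurable G volume) :
    AEStronglyMeasurable
      (uncurry fun (τ : ℝ) (x : EuclideanSpace ℝ (Fin 3)) => (T - τ) ^ (-1 : ℝ) • G ((T - τ) ^ (-γ) • (x - x₀)))
      (((volume : Measure ℝ).restrict (Iio T₁)).prod (volume : Measure (EuclideanSpace ℝ (Fin 3)))) := by
  have h1 : AEStronglyMeasurable
      (fun z : ℝ × EuclideanSpace ℝ (Fin 3) => G ((T - z.1) ^ (-γ) • (z.2 - x₀)))
      (((volume : Measure ℝ).restrict (Iio T₁)).prod (volume : Measure (EuclideanSpace ℝ (Fin 3)))) :=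
    hGm.comp_quasiMeasurePreserving (quasiMeasurePreserving_selfSimilarDilation γ hTT₁ x₀)
  have h2 : AEStronglyMeasurable (fun z : ℝ × EuclideanSpace ℝ (Fin 3) => (T - z.1) ^ (-1 : ℝ))
      (((volume : Measure ℝ).restrict (Iio T₁)).prod (volume : Measure (EuclideanSpace ℝ (Fin 3)))) :=
    ((measurable_const.sub measurable_fst).pow_const _).aestronglyMeasurable
  exact h2.smul h1

/-- **Slab form of the identification.**  Under the hypotheses of `exists_profileGradient_ae_of_past` there is a profile
gradient `G` (a.e.-strongly measurable, a weak derivative of `V` on `ℝ³`) such that `H` agrees with the self-similar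
gradient `(τ, x) ↦ (T − τ)^{−1} • G((T − τ)^{−γ}(x − x₀))` a.e. on the past sub-slab `(−∞, T₁) × ℝ³` (Lebesgue measure
restricted to `Iio T₁ ×ˢ univ`) — the form consumed by the gauge dictionary (`cknE` only sees a.e. classes). [folklore] -/
theorem exists_profileGradient_ae_slab_of_past {γ : ℝ}
    {u : ℝ → EuclideanSpace ℝ (Fin 3) → EuclideanSpace ℝ (Fin 3)}
    {H : ℝ → EuclideanSpace ℝ (Fin 3) → EuclideanSpace ℝ (Fin 3) →L[ℝ] EuclideanSpace ℝ (Fin 3)}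
    (hH : HasWeakSpatialGradientOn (slab (EuclideanSpace ℝ (Fin 3)) (Iio 0) isOpen_Iio) u H)
    {T T₁ : ℝ} (hT₁ : T₁ ≤ 0) (hTT₁ : T₁ ≤ T) (x₀ : EuclideanSpace ℝ (Fin 3))
    {V : EuclideanSpace ℝ (Fin 3) → EuclideanSpace ℝ (Fin 3)}
    (hu : ∀ τ : ℝ, τ < T₁ → u τ = fun x => selfSimilarCollapse γ T V τ (x - x₀)) :
    ∃ G : EuclideanSpace ℝ (Fin 3) → EuclideanSpace ℝ (Fin 3) →L[ℝ] EuclideanSpace ℝ (Fin 3),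
      AEStronglyMeasurable G volume ∧
      HasWeakFDerivOn (⊤ : Opens (EuclideanSpace ℝ (Fin 3))) volume V G ∧
      uncurry H =ᵐ[volume.restrict (Iio T₁ ×ˢ (univ : Set (EuclideanSpace ℝ (Fin 3))))]
        uncurry fun (τ : ℝ) (x : EuclideanSpace ℝ (Fin 3)) =>
          (T - τ) ^ (-1 : ℝ) • G ((T - τ) ^ (-γ) • (x - x₀)) := by
  obtain ⟨G, hGm, hVG, hae⟩ := exists_profileGradient_ae_of_past hH hT₁ hTT₁ x₀ hu
  refine ⟨G, hGm, hVG, ?_⟩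
  have hsub : Iio T₁ ×ˢ (univ : Set (EuclideanSpace ℝ (Fin 3))) ⊆
      Iio (0 : ℝ) ×ˢ (univ : Set (EuclideanSpace ℝ (Fin 3))) :=
    prod_mono (Iio_subset_Iio hT₁) le_rfl
  have hHm0 : AEStronglyMeasurable (uncurry H)
      (volume.restrict (Iio (0 : ℝ) ×ˢ (univ : Set (EuclideanSpace ℝ (Fin 3))))) := by
    have := hH.locallyIntegrableOn_grad.aestronglyMeasurable
    simpa [slab] using this
  have hHm : AEStronglyMeasurable (uncurry H)
      (((volume : Measure ℝ).restrict (Iio T₁)).prod (volume : Measure (EuclideanSpace ℝ (Fin 3)))) := by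
    have := hHm0.mono_measure (Measure.restrict_mono hsub le_rfl)
    rw [Measure.volume_eq_prod, ← Measure.prod_restrict, Measure.restrict_univ] at this
    exact this
  have hprod := ae_eq_prod_of_ae_ae_eq hHm (aestronglyMeasurable_uncurry_selfSimilarGradient γ hTT₁ x₀ hGm) hae
  rw [Measure.volume_eq_prod, ← Measure.prod_restrict, Measure.restrict_univ]
  exact hprod

end Past

end Summit.NavierStokesRegularity.NavierStokesRegularity.Theorems.PowerGaugeEulerLiouville
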